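import Literature.Geometry.GeometricMeasureTheory.CurrentsSlicing
import Literature.Geometry.GeometricMeasureTheory.CurrentsLipschitzPushforward
import HarnessLib

/-!
# Slicing by Lipschitz functions (Federer 4.2.1 as printed)

Support file for the proof of the named fact
`Literature.Geometry.GeometricMeasureTheory.Federer1969_compactness_integralCurrents`
(Federer–Fleming compactness, [Federer1969, 4.2.17 (2)]). `CurrentsSlicing.lean` proves the
slicing inequality and the a.e. finiteness of slice masses for SMOOTH slicing functions; Federer's
4.2.1 is stated for a Lipschitzian `u : ℝⁿ → ℝ` ("we uniformly approximate `γ_h ∘ u` by … smooth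
`χ_i` with `Lip(χ_i) → Lip(γ_h ∘ u)`"), and both the deformation theorem 4.2.9 (slicing by the
`1`-Lipschitz `u_m ∘ τ_a`) and the closure theorem 4.2.16 (slicing by `dist(·, E)`) use it for
Lipschitz, non-smooth `u`. This file performs the passage to Lipschitz `f`:

* `Current.IsRepresentable.tendsto_restrictSet_apply` — `(T ⌞ Aₙ)(φ) → (T ⌞ B)(φ)` whenever
  `1_{Aₙ} → 1_B` `‖T‖`-a.e. (dominated convergence in `L¹(‖T‖)`, continuity of `T̄`);
* `Current.IsRepresentable.tendsto_slice_apply` — for continuous `fⱼ → f` pointwise, the slices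
  `⟨T, fⱼ, r+⟩ → ⟨T, f, r+⟩` weakly at every level `r` with `‖T‖{f = r} = 0 = ‖∂T‖{f = r}`;
  `countable_variation_level_pos` / `ae_variation_level_eq_zero` — all but countably many levels
  are uncharged; `mass_slice_le_liminf_of_tendsto` — lower semicontinuity of the slice mass;
* `Current.IsRepresentable.lintegral_mass_slice_le_of_lipschitz` — **the integrated slicing
  inequality for `L`-Lipschitz `f`**: `∫_{(a,b)} 𝐌⟨T, f, r+⟩ dr ≤ C_k L ‖T‖(f⁻¹[a − δ, b + δ])`
  for every `δ > 0` (smooth `L`-Lipschitz approximants `exists_smooth_approx` by convolution, the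
  smooth majorants `liminfₙ sliceWindow`, Fatou, `lintegral_liminf_sliceWindow_le`);
* `ae_mass_slice_lt_top_of_lipschitz`, `ae_normalMass_slice_lt_top_of_lipschitz` — **almost
  every slice by a Lipschitz function has finite (normal) mass**, and
  `ae_mass_boundary_restrictSet_lt_top` — **`T ⌞ {f > r}` is normal for a.e. `r`** when `T` is
  (`𝐌(∂(T ⌞ {f > r})) ≤ 𝐌(∂T) + 𝐌⟨T, f, r+⟩`), the form used in 4.2.2/4.2.9.

No definitions, no named facts.

## References

* H. Federer, *Geometric Measure Theory*, Springer 1969, 4.2.1 (held copy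
  `lit book:federernd-geometric-measure-theory`, PDF pp. 334–336) [Federer1969].
-/

noncomputable section

open scoped Distributions ENNReal NNReal Topology ContDiff
open MeasureTheory TopologicalSpace Set Filter Metric Function

namespace Literature.Geometry.GeometricMeasureTheory

-- Nested operator-norm instances on (duals of) `E [⋀^Fin m]→L[ℝ] ℝ`.
set_option maxSynthPendingDepth 2

/-! ### `T ⌞ Aₙ → T ⌞ A` under a.e. convergence of indicators -/

section RestrictLimit

variable {E : Type*} [NormedAddCommGroup E] [NormedSpace ℝ E] [FiniteDimensional ℝ E]
  [MeasurableSpace E] [BorelSpace E] {Ω : Opens E} {m : ℕ}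

/-- **`(T ⌞ Aₙ)(φ) → (T ⌞ B)(φ)`** when `1_{Aₙ} → 1_B` `‖T‖`-almost everywhere (dominated
convergence in `L¹(‖T‖)` and continuity of `T̄`). [cite: Federer1969, 4.1.7] -/
theorem Current.IsRepresentable.tendsto_restrictSet_apply {T : Current Ω m} (hT : T.IsRepresentable)
    {A : ℕ → Set E} (hA : ∀ n, MeasurableSet (A n)) {B : Set E} (hB : MeasurableSet B)
    (hlim : ∀ᵐ x ∂T.variation, Tendsto (fun n => (A n).indicator (1 : E → ℝ) x) atTop
      (𝓝 (B.indicator 1 x)))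
    (φ : TestForm Ω m) :
    Tendsto (fun n => hT.restrictSet (A n) (hA n) φ) atTop (𝓝 (hT.restrictSet B hB φ)) := by
  simp_rw [hT.restrictSet_apply]
  refine (hT.extend.continuous.tendsto _).comp ?_
  rw [tendsto_iff_norm_sub_tendsto_zero]
  have hnorm : ∀ n, ‖((hT.integrable_testForm φ).indicator (hA n)).toL1 ((A n).indicator ⇑φ) -
      ((hT.integrable_testForm φ).indicator hB).toL1 (B.indicator ⇑φ)‖ =
        (∫⁻ x, ‖(A n).indicator ⇑φ x - B.indicator ⇑φ x‖ₑ ∂T.variation).toReal := fun n => by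
    rw [← Integrable.toL1_sub, Integrable.norm_toL1_eq_lintegral_enorm]; rfl
  simp_rw [hnorm]
  have hdct : Tendsto (fun n => ∫⁻ x, ‖(A n).indicator ⇑φ x - B.indicator ⇑φ x‖ₑ ∂T.variation) atTop
      (𝓝 (∫⁻ _, (0 : ℝ≥0∞) ∂T.variation)) := by
    refine tendsto_lintegral_of_dominated_convergence' (fun x => 2 * ‖φ x‖ₑ)
      (fun n => ?_) (fun n => Eventually.of_forall fun x => ?_) ?_ ?_
    · exact ((φ.continuous.aestronglyMeasurable.indicator (hA n)).sub
        (φ.continuous.aestronglyMeasurable.indicator hB)).enorm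
    · show ‖(A n).indicator ⇑φ x - B.indicator ⇑φ x‖ₑ ≤ 2 * ‖φ x‖ₑ
      rw [← ofReal_norm, ← ofReal_norm, ← ENNReal.ofReal_ofNat, ← ENNReal.ofReal_mul zero_le_two]
      apply ENNReal.ofReal_le_ofReal
      calc ‖(A n).indicator ⇑φ x - B.indicator ⇑φ x‖
          ≤ ‖(A n).indicator ⇑φ x‖ + ‖B.indicator ⇑φ x‖ := norm_sub_le _ _
        _ ≤ ‖φ x‖ + ‖φ x‖ := add_le_add (norm_indicator_le_norm_self _ _)
            (norm_indicator_le_norm_self _ _)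
        _ = 2 * ‖φ x‖ := by ring
    · rw [lintegral_const_mul' _ _ (by simp)]
      exact ENNReal.mul_ne_top (by simp) (hT.lintegral_enorm_ne_top φ)
    · filter_upwards [hlim] with x hx
      have h1 : Tendsto (fun n => (A n).indicator ⇑φ x - B.indicator ⇑φ x) atTop (𝓝 0) := by
        have h2 := (hx.smul_const (φ x)).sub_const (B.indicator ⇑φ x)
        have h3 : B.indicator (1 : E → ℝ) x • φ x - B.indicator ⇑φ x = 0 := by
          by_cases hxB : x ∈ B <;> simp [hxB]
        have h4 : ∀ n, (A n).indicator (1 : E → ℝ) x • φ x = (A n).indicator ⇑φ x := fun n => by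
          by_cases hxA : x ∈ A n <;> simp [hxA]
        rw [h3] at h2
        simpa only [h4] using h2
      simpa [Function.comp_def] using (continuous_enorm.tendsto (0 : Covector E m)).comp h1
  rw [lintegral_zero] at hdct
  simpa [Function.comp_def] using (ENNReal.tendsto_toReal ENNReal.zero_ne_top).comp hdct

/-- **Superlevel sets of approximating functions**: if `fⱼ → f` pointwise and `f x ≠ r`, then
`1_{fⱼ > r}(x) → 1_{f > r}(x)` (eventually constant). [folklore] -/
theorem tendsto_indicator_superlevel {X : Type*} {f : X → ℝ} {g : ℕ → X → ℝ} {x : X} {r : ℝ}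
    (hg : Tendsto (fun j => g j x) atTop (𝓝 (f x))) (hx : f x ≠ r) :
    Tendsto (fun j => {y | r < g j y}.indicator (1 : X → ℝ) x) atTop
      (𝓝 ({y | r < f y}.indicator 1 x)) := by
  rcases lt_or_gt_of_ne hx with h | h
  · have hev : ∀ᶠ j in atTop, g j x < r := hg (Iio_mem_nhds h)
    refine tendsto_const_nhds.congr' ?_
    filter_upwards [hev] with j hj
    rw [indicator_of_notMem (show x ∉ {y | r < f y} from fun h' => (lt_asymm h) h'),
      indicator_of_notMem (show x ∉ {y | r < g j y} from fun h' => (lt_asymm hj) h')]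
  · have hev : ∀ᶠ j in atTop, r < g j x := hg (Ioi_mem_nhds h)
    refine tendsto_const_nhds.congr' ?_
    filter_upwards [hev] with j hj
    rw [indicator_of_mem (show x ∈ {y | r < f y} from h), indicator_of_mem (show x ∈ {y | r < g j y} from hj)]

end RestrictLimit

/-! ### Weak convergence of slices along approximating slicing functions -/

section SliceLimit

variable {E : Type*} [NormedAddCommGroup E] [NormedSpace ℝ E] [FiniteDimensional ℝ E]
  [MeasurableSpace E] [BorelSpace E] {Ω : Opens E} {k : ℕ}

/-- **Slices converge weakly along `fⱼ → f`** at every level `r` charged neither by `‖T‖` nor by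
`‖∂T‖`: `⟨T, fⱼ, r+⟩(φ) → ⟨T, f, r+⟩(φ)`. [cite: Federer1969, 4.2.1] -/
theorem Current.IsRepresentable.tendsto_slice_apply {T : Current Ω (k + 1)} (hT : T.IsRepresentable)
    (hdT : T.boundary.IsRepresentable) {f : E → ℝ} (hf : Continuous f) {g : ℕ → E → ℝ}
    (hg : ∀ j, Continuous (g j)) (hlim : ∀ x, Tendsto (fun j => g j x) atTop (𝓝 (f x))) {r : ℝ}
    (hr : T.variation {x | f x = r} = 0) (hdr : T.boundary.variation {x | f x = r} = 0)
    (φ : TestForm Ω k) :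
    Tendsto (fun j => hT.slice hdT (hg j) r φ) atTop (𝓝 (hT.slice hdT hf r φ)) := by
  simp_rw [hT.slice_apply]
  have hae : ∀ (ρ : Measure E), ρ {x | f x = r} = 0 → ∀ᵐ x ∂ρ,
      Tendsto (fun j => {y | r < g j y}.indicator (1 : E → ℝ) x) atTop
        (𝓝 ({y | r < f y}.indicator 1 x)) := fun ρ hρ => by
    have : ∀ᵐ x ∂ρ, f x ≠ r := by
      rw [ae_iff]; simpa using hρ
    exact this.mono fun x hx => tendsto_indicator_superlevel (hlim x) hx
  exact (hdT.tendsto_restrictSet_apply (fun j => measurableSet_lt_of_continuous (hg j) r)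
    (measurableSet_lt_of_continuous hf r) (hae _ hdr) φ).sub
    (hT.tendsto_restrictSet_apply (fun j => measurableSet_lt_of_continuous (hg j) r)
      (measurableSet_lt_of_continuous hf r) (hae _ hr) (TestForm.extDerivCLM φ))

/-- **All but countably many levels are uncharged**: for a representable current, the set of `r`
with `‖T‖{f = r} > 0` is countable. [folklore] -/
theorem Current.IsRepresentable.countable_variation_level_pos {m : ℕ} {T : Current Ω m}
    (hT : T.IsRepresentable) {f : E → ℝ} (hf : Continuous f) :
    Set.Countable {r : ℝ | 0 < T.variation {x | f x = r}} := by
  haveI := hT.sigmaFinite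
  refine Measure.countable_meas_pos_of_disjoint_iUnion (μ := T.variation)
    (As := fun r : ℝ => {x | f x = r}) (fun r => (isClosed_eq hf continuous_const).measurableSet) ?_
  intro r s hrs
  exact Set.disjoint_left.2 fun x (hx : f x = r) (hx' : f x = s) => hrs (hx.symm.trans hx')

/-- Hence, for Lebesgue-a.e. level, `‖T‖{f = r} = 0`. [folklore] -/
theorem Current.IsRepresentable.ae_variation_level_eq_zero {m : ℕ} {T : Current Ω m}
    (hT : T.IsRepresentable) {f : E → ℝ} (hf : Continuous f) :
    ∀ᵐ r ∂(volume : Measure ℝ), T.variation {x | f x = r} = 0 := by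
  have h := (hT.countable_variation_level_pos hf).ae_notMem (volume : Measure ℝ)
  filter_upwards [h] with r hr
  simpa using hr

/-- **Lower semicontinuity of the slice mass along `fⱼ → f`** at uncharged levels.
[cite: Federer1969, 4.2.1] -/
theorem Current.IsRepresentable.mass_slice_le_liminf_of_tendsto {T : Current Ω (k + 1)}
    (hT : T.IsRepresentable) (hdT : T.boundary.IsRepresentable) {f : E → ℝ} (hf : Continuous f)
    {g : ℕ → E → ℝ} (hg : ∀ j, Continuous (g j)) (hlim : ∀ x, Tendsto (fun j => g j x) atTop (𝓝 (f x)))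
    {r : ℝ} (hr : T.variation {x | f x = r} = 0) (hdr : T.boundary.variation {x | f x = r} = 0) :
    (hT.slice hdT hf r).mass ≤ liminf (fun j => (hT.slice hdT (hg j) r).mass) atTop :=
  Current.mass_le_liminf (hT.tendsto_slice_apply hdT hf hg hlim hr hdr)

end SliceLimit

/-! ### The integrated slicing inequality for Lipschitz functions -/

section SliceIntegralLip

variable {E : Type*} [NormedAddCommGroup E] [NormedSpace ℝ E] [FiniteDimensional ℝ E]
  [MeasurableSpace E] [BorelSpace E] {Ω : Opens E} {k : ℕ}

omit [MeasurableSpace E] [BorelSpace E] in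
/-- Smooth `L`-Lipschitz approximants `fⱼ` of an `L`-Lipschitz `f` with `‖fⱼ − f‖ ≤ δ/(j+1)`
(convolution; `exists_contDiff_lipschitzWith_dist_le_of_lipschitzWith`). [folklore] -/
theorem exists_smooth_approx {f : E → ℝ} {L : ℝ≥0} (hf : LipschitzWith L f) {δ : ℝ} (hδ : 0 < δ) :
    ∃ g : ℕ → E → ℝ, (∀ j, ContDiff ℝ ∞ (g j)) ∧ (∀ j x, ‖fderiv ℝ (g j) x‖ ≤ L) ∧
      (∀ j x, dist (g j x) (f x) ≤ δ / ((j : ℝ) + 1)) := by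
  have h := fun j : ℕ => exists_contDiff_lipschitzWith_dist_le_of_lipschitzWith hf
    (ε := δ / ((j : ℝ) + 1)) (by positivity)
  choose g hg1 hg2 hg3 using h
  exact ⟨g, hg1, fun j x => norm_fderiv_le_of_lipschitz ℝ (hg2 j), hg3⟩

/-- The approximants converge pointwise. [folklore] -/
theorem tendsto_of_dist_le_div {X : Type*} {f : X → ℝ} {g : ℕ → X → ℝ} {δ : ℝ}
    (h : ∀ j x, dist (g j x) (f x) ≤ δ / ((j : ℝ) + 1)) (x : X) :
    Tendsto (fun j => g j x) atTop (𝓝 (f x)) := by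
  rw [tendsto_iff_dist_tendsto_zero]
  refine squeeze_zero (fun j => dist_nonneg) (fun j => h j x) ?_
  have := tendsto_const_div_atTop_nhds_zero_nat δ |>.comp (tendsto_add_atTop_nat 1)
  refine this.congr fun j => ?_
  simp [Function.comp]

/-- **The integrated slicing inequality for Lipschitz `f`** [Federer1969, 4.2.1:
"`∫_a^{*b} 𝐌⟨T, u, r+⟩ dℒ¹ r ≤ Lip(u) ‖T‖ {x : a < u(x) < b}`", `u` Lipschitz], here as
`∫_{(a,b)} 𝐌⟨T, f, r+⟩ dr ≤ C_k · L · ‖T‖(f⁻¹[a − δ, b + δ])` for every `δ > 0` (smooth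
`L`-Lipschitz approximants, weak convergence of slices at uncharged levels, lower semicontinuity of
`𝐌`, Fatou, and the smooth inequality `lintegral_liminf_sliceWindow_le`). [cite: Federer1969, 4.2.1] -/
theorem Current.IsRepresentable.lintegral_mass_slice_le_of_lipschitz {T : Current Ω (k + 1)}
    (hT : T.IsRepresentable) (hdT : T.boundary.IsRepresentable) {f : E → ℝ} {L : ℝ≥0}
    (hf : LipschitzWith L f) (a b : ℝ) {δ : ℝ} (hδ : 0 < δ) :
    ∫⁻ r in Ioo a b, (hT.slice hdT hf.continuous r).mass ≤
      ENNReal.ofReal (sliceConst k) * ENNReal.ofReal L * T.variation (f ⁻¹' Icc (a - δ) (b + δ)) := by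
  obtain ⟨g, hg, hDg, hdist⟩ := exists_smooth_approx hf (half_pos hδ)
  have hgc : ∀ j, Continuous (g j) := fun j => (hg j).continuous
  have hlim : ∀ x, Tendsto (fun j => g j x) atTop (𝓝 (f x)) := tendsto_of_dist_le_div hdist
  -- the measurable majorants `G j r = liminfₙ sliceWindow T (g j) n r`
  set G : ℕ → ℝ → ℝ≥0∞ := fun j r => liminf (fun n => sliceWindow T (g j) n r) atTop with hGdef
  have hGm : ∀ j, Measurable (G j) := fun j => Measurable.liminf fun n => measurable_sliceWindow hT (hg j) n
  -- a.e. in `r`: `𝐌⟨T, f, r+⟩ ≤ liminf_j G j r`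
  have hae : ∀ᵐ r ∂(volume : Measure ℝ), (hT.slice hdT hf.continuous r).mass ≤
      liminf (fun j => G j r) atTop := by
    filter_upwards [hT.ae_variation_level_eq_zero hf.continuous,
      hdT.ae_variation_level_eq_zero hf.continuous] with r hr hdr
    refine (hT.mass_slice_le_liminf_of_tendsto hdT hf.continuous hgc hlim hr hdr).trans ?_
    exact liminf_le_liminf (Eventually.of_forall fun j => hT.mass_slice_le_liminf hdT (hg j) r)
  -- integrate: Fatou and the smooth inequality
  calc ∫⁻ r in Ioo a b, (hT.slice hdT hf.continuous r).mass
      ≤ ∫⁻ r in Ioo a b, liminf (fun j => G j r) atTop := lintegral_mono_ae (ae_restrict_of_ae hae)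
    _ ≤ liminf (fun j => ∫⁻ r in Ioo a b, G j r) atTop := lintegral_liminf_le fun j => hGm j
    _ ≤ ENNReal.ofReal (sliceConst k) * ENNReal.ofReal L * T.variation (f ⁻¹' Icc (a - δ) (b + δ)) := by
        refine liminf_le_of_frequently_le' (Frequently.of_forall fun j => ?_)
        refine (hT.lintegral_liminf_sliceWindow_le (hg j) a b (half_pos hδ)).trans ?_
        rw [mul_assoc]
        refine mul_le_mul' le_rfl ?_
        calc ∫⁻ x in g j ⁻¹' Icc a (b + δ / 2), ‖fderiv ℝ (g j) x‖ₑ ∂T.variation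
            ≤ ∫⁻ _ in g j ⁻¹' Icc a (b + δ / 2), ENNReal.ofReal L ∂T.variation :=
              lintegral_mono fun x => by rw [← ofReal_norm]; exact ENNReal.ofReal_le_ofReal (hDg j x)
          _ = ENNReal.ofReal L * T.variation (g j ⁻¹' Icc a (b + δ / 2)) := by rw [setLIntegral_const]
          _ ≤ ENNReal.ofReal L * T.variation (f ⁻¹' Icc (a - δ) (b + δ)) := by
              refine mul_le_mul' le_rfl (measure_mono fun x hx => ?_)
              simp only [mem_preimage, mem_Icc] at hx ⊢
              have hd := hdist j x
              rw [Real.dist_eq, abs_le] at hd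
              have : δ / 2 / ((j : ℝ) + 1) ≤ δ / 2 :=
                div_le_self (half_pos hδ).le (by linarith [j.cast_nonneg (α := ℝ)])
              constructor <;> linarith [hd.1, hd.2]

/-- **Almost every slice by a Lipschitz function has finite mass** (`𝐌(T) < ∞`). [cite: Federer1969, 4.2.1] -/
theorem Current.IsRepresentable.ae_mass_slice_lt_top_of_lipschitz {T : Current Ω (k + 1)}
    (hT : T.IsRepresentable) (hdT : T.boundary.IsRepresentable) {f : E → ℝ} {L : ℝ≥0}
    (hf : LipschitzWith L f) (hmass : T.mass ≠ ⊤) :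
    ∀ᵐ r ∂(volume : Measure ℝ), (hT.slice hdT hf.continuous r).mass < ⊤ := by
  obtain ⟨g, hg, hDg, hdist⟩ := exists_smooth_approx hf one_pos
  have hgc : ∀ j, Continuous (g j) := fun j => (hg j).continuous
  have hlim : ∀ x, Tendsto (fun j => g j x) atTop (𝓝 (f x)) := tendsto_of_dist_le_div hdist
  set G : ℕ → ℝ → ℝ≥0∞ := fun j r => liminf (fun n => sliceWindow T (g j) n r) atTop with hGdef
  have hGm : ∀ j, Measurable (G j) := fun j => Measurable.liminf fun n => measurable_sliceWindow hT (hg j) n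
  have hae : ∀ᵐ r ∂(volume : Measure ℝ), (hT.slice hdT hf.continuous r).mass ≤
      liminf (fun j => G j r) atTop := by
    filter_upwards [hT.ae_variation_level_eq_zero hf.continuous,
      hdT.ae_variation_level_eq_zero hf.continuous] with r hr hdr
    refine (hT.mass_slice_le_liminf_of_tendsto hdT hf.continuous hgc hlim hr hdr).trans ?_
    exact liminf_le_liminf (Eventually.of_forall fun j => hT.mass_slice_le_liminf hdT (hg j) r)
  -- the majorant `liminf_j G j` is a.e. finite on every bounded interval
  have hfin : ∀ N : ℕ, ∀ᵐ r ∂(volume : Measure ℝ), r ∈ Ioo (-(N : ℝ)) N →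
      liminf (fun j => G j r) atTop < ⊤ := by
    intro N
    have hbound : ∫⁻ r in Ioo (-(N : ℝ)) N, liminf (fun j => G j r) atTop ≤
        ENNReal.ofReal (sliceConst k) * ENNReal.ofReal L * T.mass := by
      refine (lintegral_liminf_le fun j => hGm j).trans ?_
      refine liminf_le_of_frequently_le' (Frequently.of_forall fun j => ?_)
      refine (hT.lintegral_liminf_sliceWindow_le (hg j) (-(N : ℝ)) N one_pos).trans ?_
      rw [mul_assoc]
      refine mul_le_mul' le_rfl ?_
      calc ∫⁻ x in g j ⁻¹' Icc (-(N : ℝ)) (N + 1), ‖fderiv ℝ (g j) x‖ₑ ∂T.variation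
          ≤ ∫⁻ _ in g j ⁻¹' Icc (-(N : ℝ)) (N + 1), ENNReal.ofReal L ∂T.variation :=
            lintegral_mono fun x => by rw [← ofReal_norm]; exact ENNReal.ofReal_le_ofReal (hDg j x)
        _ ≤ ENNReal.ofReal L * T.mass := by
            rw [setLIntegral_const]
            exact mul_le_mul' le_rfl (T.variation_le_mass _)
    have hne : ∫⁻ r in Ioo (-(N : ℝ)) N, liminf (fun j => G j r) atTop ≠ ⊤ :=
      ne_top_of_le_ne_top (ENNReal.mul_ne_top (ENNReal.mul_ne_top ENNReal.ofReal_ne_top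
        ENNReal.ofReal_ne_top) hmass) hbound
    have hmeas : Measurable fun r => liminf (fun j => G j r) atTop := Measurable.liminf hGm
    have := ae_lt_top' hmeas.aemeasurable hne
    exact (ae_restrict_iff' measurableSet_Ioo).1 this
  rw [← ae_all_iff] at hfin
  filter_upwards [hfin, hae] with r hr hr'
  obtain ⟨N, hN⟩ := exists_nat_gt |r|
  have hrN : r ∈ Ioo (-(N : ℝ)) N := ⟨by linarith [neg_abs_le r], lt_of_le_of_lt (le_abs_self r) hN⟩
  exact hr'.trans_lt (hr N hrN)

/-- **Almost every slice of a normal current by a Lipschitz function is normal.**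
[cite: Federer1969, 4.2.1] -/
theorem Current.IsRepresentable.ae_normalMass_slice_lt_top_of_lipschitz {T : Current Ω (k + 2)}
    (hT : T.IsRepresentable) (hdT : T.boundary.IsRepresentable) {f : E → ℝ} {L : ℝ≥0}
    (hf : LipschitzWith L f) (hmass : T.mass ≠ ⊤) (hbmass : T.boundary.mass ≠ ⊤) :
    ∀ᵐ r ∂(volume : Measure ℝ), (hT.slice hdT hf.continuous r).normalMass < ⊤ := by
  have hddT : T.boundary.boundary.IsRepresentable := by
    rw [Current.boundary_boundary]; exact Current.isRepresentable_zero
  filter_upwards [hT.ae_mass_slice_lt_top_of_lipschitz hdT hf hmass,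
    hdT.ae_mass_slice_lt_top_of_lipschitz hddT hf hbmass] with r h1 h2
  unfold Current.normalMass
  rw [hT.boundary_slice hdT hddT hf.continuous r, Current.mass_neg]
  exact ENNReal.add_lt_top.2 ⟨h1, h2⟩

/-- **`T ⌞ {f > r}` is normal for almost every level** when `T` is (`𝐌(T), 𝐌(∂T) < ∞`):
`𝐌(∂(T ⌞ {f > r})) ≤ 𝐌(∂T) + 𝐌⟨T, f, r+⟩ < ∞`. [cite: Federer1969, 4.2.1] -/
theorem Current.IsRepresentable.ae_mass_boundary_restrictSet_lt_top {T : Current Ω (k + 1)}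
    (hT : T.IsRepresentable) (hdT : T.boundary.IsRepresentable) {f : E → ℝ} {L : ℝ≥0}
    (hf : LipschitzWith L f) (hmass : T.mass ≠ ⊤) (hbmass : T.boundary.mass ≠ ⊤) :
    ∀ᵐ r ∂(volume : Measure ℝ),
      (hT.restrictSet {x | r < f x} (measurableSet_lt_of_continuous hf.continuous r)).boundary.mass < ⊤ := by
  filter_upwards [hT.ae_mass_slice_lt_top_of_lipschitz hdT hf hmass] with r hr
  have e : (hT.restrictSet {x | r < f x} (measurableSet_lt_of_continuous hf.continuous r)).boundary =
      hdT.restrictSet {x | r < f x} (measurableSet_lt_of_continuous hf.continuous r) -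
        hT.slice hdT hf.continuous r := by
    rw [Current.IsRepresentable.slice, sub_sub_cancel]
  rw [e, sub_eq_add_neg]
  refine (Current.mass_add_le _ _).trans_lt (ENNReal.add_lt_top.2 ⟨?_, ?_⟩)
  · exact (hdT.mass_restrictSet_le _).trans_lt ((T.boundary.variation_le_mass _).trans_lt hbmass.lt_top)
  · rw [Current.mass_neg]; exact hr

end SliceIntegralLip

end Literature.Geometry.GeometricMeasureTheory
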